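import Literature.Computability.Complexity.OracleFirstQuery
import Literature.Computability.Complexity.ListFoldChecks
import Literature.Computability.Complexity.ListBricks
import Literature.Computability.Complexity.HashBricks
import HarnessLib

/-!
# One-query oracle algorithms assembled from polynomial-time stages

Topic `Literature/Computability/Complexity`; companion of `OracleSimulateFP.lean` and
`OracleFirstQuery.lean`. A reduction that turns an adversary `A'` against a composite scheme into a
ONE-query adversary `A` against a component (Goldreich 2004, proof of Prop. 6.4.31: the forger against
the length-restricted scheme asks its signing oracle once, on the hashed first query of the emulated
`A'`, and then finishes the emulation by itself) has the shape

  "on `x`: if `D x` then ask `Q x` and, on the answer `a`, output `Out₁ ⟨x, a⟩; else output `Out₀ x`",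

with `D, Q, Out₀, Out₁` polynomial-time STRING functions (typically `OracleAlg.firstQueryFn` and
`OracleAlg.simPairFn` emulations). This file packages that shape once, in the transcript model:

* `OracleAlg.oneQuery D Q Out₀ Out₁` — the algorithm; `run_oneQuery_pos/neg`, `queries_oneQuery_pos/neg`
  (its run and transcript against any oracle: one query `Q x` answered `O (Q x)`, or none);
* **`OracleAlg.isPolyTime_oneQuery`** — polynomial time for `D, Q, Out₀, Out₁ ∈ FP` and `D` one-bit
  (the step code is an `iteFn` cascade on the coded transcript `⟨x, ⟨1^{|as|}, encList as⟩⟩`);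
* `OracleAlg.asksFirstFn M pre` — the one-bit stage "does `M` ask at its first step on `pre w`?"
  (`asksFirstFn_mem_FP`: the complemented tag bit of the step code on the empty transcript), the
  typical `D`;
* the pair-output form `OracleAlg.oneQueryPair` (outputs re-read as pairs `(fstF s, sndF s)`, for the
  forgers of the signature games) with `isPolyTime_oneQueryPair` (via `IsPolyTime.mapOut_of_range`,
  for pair-shaped `Out₀`, `Out₁`) and its runs.

## References

* S. Arora, B. Barak, *Computational Complexity: A Modern Approach*, CUP 2009, §3.4, §1.3.
* O. Goldreich, *Foundations of Cryptography II: Basic Applications*, CUP 2004, §6.4.3.3 (proof of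
  Prop. 6.4.31, the forger `A`), as the consumer shape.
-/

namespace Literature.Computability.Complexity

open _root_.Computability Polynomial Brick HashBricks

namespace OracleAlg

/-! ### The algorithm and its runs -/

/-- **The one-query algorithm** from stages `D` (decision), `Q` (query), `Out₀` (output without asking),
`Out₁` (output from the answer): a second answer is never requested (junk output `⟨ε, ε⟩` on longer
transcripts). [Goldreich 2004, proof of Prop. 6.4.31 (the forger `A`)] [cite: Goldreich2004, Prop. 6.4.31] -/
def oneQuery (D Q Out₀ Out₁ : List Bool → List Bool) : OracleAlg (List Bool) where
  step x as := match as with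
    | [] => if D x = [true] then Sum.inl (Q x) else Sum.inr (Out₀ x)
    | [a] => Sum.inr (Out₁ (boolPair x a))
    | _ :: _ :: _ => Sum.inr (boolPair [] [])

variable (D Q Out₀ Out₁ : List Bool → List Bool)

/-- Run, querying case: ask `Q x`, output `Out₁ ⟨x, O (Q x)⟩` (two rounds). [folklore] -/
theorem run_oneQuery_pos (O : Oracle) {x : List Bool} (hD : D x = [true]) (k : ℕ) :
    (oneQuery D Q Out₀ Out₁).run O (k + 2) x = some (Out₁ (boolPair x (O (Q x)))) := by
  rw [run, runAux_succ]
  simp only [oneQuery, hD, if_true, List.nil_append]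
  rw [runAux_succ]

/-- Transcript, querying case: `[Q x]`. [folklore] -/
theorem queries_oneQuery_pos (O : Oracle) {x : List Bool} (hD : D x = [true]) (k : ℕ) :
    (oneQuery D Q Out₀ Out₁).queries O (k + 2) x = [Q x] := by
  rw [queries, queriesAux]
  simp only [oneQuery, hD, if_true, List.nil_append]
  rw [queriesAux]

/-- Run, silent case: output `Out₀ x` at once. [folklore] -/
theorem run_oneQuery_neg (O : Oracle) {x : List Bool} (hD : D x ≠ [true]) (k : ℕ) :
    (oneQuery D Q Out₀ Out₁).run O (k + 1) x = some (Out₀ x) := by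
  rw [run, runAux_succ]
  simp only [oneQuery, hD, if_false]

/-- Transcript, silent case: no query. [folklore] -/
theorem queries_oneQuery_neg (O : Oracle) {x : List Bool} (hD : D x ≠ [true]) (k : ℕ) :
    (oneQuery D Q Out₀ Out₁).queries O (k + 1) x = [] := by
  rw [queries, queriesAux]
  simp only [oneQuery, hD, if_false]

/-- Every transcript of the one-query algorithm has at most the one query `Q x`. [folklore] -/
theorem queries_oneQuery_subset (O : Oracle) (x : List Bool) (k : ℕ) :
    ∀ q ∈ (oneQuery D Q Out₀ Out₁).queries O k x, q = Q x := by
  intro q hq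
  cases k with
  | zero => simp [queries, queriesAux] at hq
  | succ k =>
    by_cases hD : D x = [true]
    · cases k with
      | zero =>
        rw [queries, queriesAux] at hq
        simp only [oneQuery, hD, if_true] at hq
        rw [queriesAux] at hq
        simpa using hq
      | succ k => rw [queries_oneQuery_pos D Q Out₀ Out₁ O hD] at hq; simpa using hq
    · rw [queries_oneQuery_neg D Q Out₀ Out₁ O hD] at hq; simp at hq

/-! ### Polynomial time -/

/-- The step code of `oneQuery` as a string function of the coded step input
`⟨x, ⟨1^{|as|}, encList as⟩⟩`. [folklore] -/
noncomputable def stepFn : List Bool → List Bool :=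
  iteFn (isNilFn ∘ fstF ∘ sndF)
    (iteFn (D ∘ fstF) (List.cons false ∘ Q ∘ fstF) (List.cons true ∘ Out₀ ∘ fstF))
    (iteFn (eqPairFn ∘ fanoutFn (fstF ∘ sndF) fun _ => [true])
      (List.cons true ∘ Out₁ ∘ fanoutFn fstF (fstF ∘ sndF ∘ sndF))
      fun _ => true :: boolPair [] [])

/-- `stepFn ∈ FP`. [folklore] -/
theorem stepFn_mem_FP (hD : D ∈ FP) (hQ : Q ∈ FP) (h₀ : Out₀ ∈ FP) (h₁ : Out₁ ∈ FP) : stepFn D Q Out₀ Out₁ ∈ FP :=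
  iteFn_mem_FP (comp_mem_FP isNilFn_mem_FP (comp_mem_FP fstF_mem_FP sndF_mem_FP))
    (iteFn_mem_FP (comp_mem_FP hD fstF_mem_FP) (comp_mem_FP (cons_mem_FP false) (comp_mem_FP hQ fstF_mem_FP))
      (comp_mem_FP (cons_mem_FP true) (comp_mem_FP h₀ fstF_mem_FP)))
    (iteFn_mem_FP (comp_mem_FP eqPairFn_mem_FP (fanoutFn_mem_FP (comp_mem_FP fstF_mem_FP sndF_mem_FP) (const_mem_FP _)))
      (comp_mem_FP (cons_mem_FP true) (comp_mem_FP h₁ (fanoutFn_mem_FP fstF_mem_FP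
        (comp_mem_FP fstF_mem_FP (comp_mem_FP sndF_mem_FP sndF_mem_FP)))))
      (const_mem_FP _))

/-- **Semantics of `stepFn`**: on the coded step input it is the code of the step result. [folklore] -/
theorem stepFn_apply (hD1 : OneBit D) (x : List Bool) (as : List (List Bool)) :
    stepFn D Q Out₀ Out₁ (boolPair x ((encodingList Bool).listBool.encode as)) =
      ((encodingList Bool).sumBool (encodingList Bool)).encode ((oneQuery D Q Out₀ Out₁).step x as) := by
  have hmap : as.map (encodingList Bool).encode = as := List.map_id' as
  have hu0 : unaryEncodeNat 0 = [] := rfl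
  have hu1 : unaryEncodeNat 1 = [true] := rfl
  have hu2 : ∀ k, unaryEncodeNat (k + 2) = true :: true :: unaryEncodeNat k := fun k => rfl
  rw [listBool_encode_eq_encList, hmap]
  obtain ⟨b, hb⟩ := hD1 x
  rcases as with _ | ⟨a, _ | ⟨a', rest⟩⟩
  · -- no answer yet
    rw [List.length_nil, hu0]
    have h0 : (isNilFn ∘ fstF ∘ sndF) (boolPair x (boolPair [] (encList []))) = [true] := by
      simp [isNilFn]
    rw [stepFn, iteFn_apply h0, if_pos rfl, iteFn_apply (by simpa using hb)]
    simp only [oneQuery, hb, Function.comp_apply, fstF_boolPair]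
    cases b <;> simp [Encoding.sumBool] <;> rfl
  · -- one answer
    rw [List.length_cons, List.length_nil, Nat.zero_add, hu1]
    have h0 : (isNilFn ∘ fstF ∘ sndF) (boolPair x (boolPair [true] (encList [a]))) = [false] := by
      simp [isNilFn]
    have h1 : (eqPairFn ∘ fanoutFn (fstF ∘ sndF) fun _ => [true]) (boolPair x (boolPair [true] (encList [a]))) = [true] := by
      simp [eqPairFn_boolPair]
    rw [stepFn, iteFn_apply h0]
    simp only [Bool.false_eq_true, if_false]
    rw [iteFn_apply h1, if_pos rfl]
    simp [oneQuery, Encoding.sumBool, encList_cons]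
    rfl
  · -- two or more answers
    rw [List.length_cons, List.length_cons, hu2]
    have h0 : (isNilFn ∘ fstF ∘ sndF) (boolPair x (boolPair (true :: true :: unaryEncodeNat rest.length) (encList (a :: a' :: rest)))) = [false] := by
      simp [isNilFn]
    have h1 : (eqPairFn ∘ fanoutFn (fstF ∘ sndF) fun _ => [true])
        (boolPair x (boolPair (true :: true :: unaryEncodeNat rest.length) (encList (a :: a' :: rest)))) = [false] := by
      simp [eqPairFn_boolPair]
    rw [stepFn, iteFn_apply h0]
    simp only [Bool.false_eq_true, if_false]
    rw [iteFn_apply h1]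
    simp only [Bool.false_eq_true, if_false, oneQuery]
    rfl

/-- **`oneQuery D Q Out₀ Out₁` is polynomial-time** for `D, Q, Out₀, Out₁ ∈ FP` with `D` one-bit.
[Arora–Barak 2009, §3.4 with §1.3] [cite: AroraBarak2009, §3.4] -/
theorem isPolyTime_oneQuery (hD : D ∈ FP) (hD1 : OneBit D) (hQ : Q ∈ FP) (h₀ : Out₀ ∈ FP) (h₁ : Out₁ ∈ FP) :
    (oneQuery D Q Out₀ Out₁).IsPolyTime (encodingList Bool) := by
  unfold IsPolyTime
  refine PolyTimeComputable.of_encode (stepFn_mem_FP D Q Out₀ Out₁ hD hQ h₀ h₁)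
    (fun p : List Bool × List (List Bool) => boolPair p.1 ((encodingList Bool).listBool.encode p.2)) (fun _ => rfl) fun p => ?_
  obtain ⟨x, as⟩ := p
  exact stepFn_apply D Q Out₀ Out₁ hD1 x as

/-! ### Does the emulated algorithm ask? -/

/-- The one-bit test "`M` asks a query at its first step on `pre w`". [Goldreich 2004, proof of Prop. 6.4.31]
[cite: Goldreich2004, Prop. 6.4.31] -/
def asksFirstFn {β : Type} (M : OracleAlg β) (pre : List Bool → List Bool) (w : List Bool) : List Bool :=
  match M.step (pre w) [] with
  | Sum.inl _ => [true]
  | Sum.inr _ => [false]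

/-- `asksFirstFn` is one-bit. [folklore] -/
theorem oneBit_asksFirstFn {β : Type} (M : OracleAlg β) (pre : List Bool → List Bool) : OneBit (asksFirstFn M pre) := fun w => by
  unfold asksFirstFn; cases M.step (pre w) [] <;> exact ⟨_, rfl⟩

/-- `asksFirstFn M pre w = [true]` iff the first step is a query. [folklore] -/
theorem asksFirstFn_eq_true_iff {β : Type} (M : OracleAlg β) (pre : List Bool → List Bool) (w : List Bool) :
    asksFirstFn M pre w = [true] ↔ ∃ q, M.step (pre w) [] = Sum.inl q := by
  unfold asksFirstFn
  cases M.step (pre w) [] with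
  | inl q => exact ⟨fun _ => ⟨q, rfl⟩, fun _ => rfl⟩
  | inr b => simp

/-- **`asksFirstFn ∈ FP`** for `M` polynomial-time and `pre ∈ FP`: the complement of the tag bit of the step
code on the empty transcript (`⟨pre w, listBool []⟩ = ⟨pre w, 01⟩`). [Arora–Barak 2009, §3.4 with §1.3]
[cite: AroraBarak2009, §3.4] -/
theorem asksFirstFn_mem_FP {β : Type} {M : OracleAlg β} {eb : Encoding β Bool} (hM : M.IsPolyTime eb)
    {pre : List Bool → List Bool} (hpre : pre ∈ FP) : asksFirstFn M pre ∈ FP := by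
  -- the step argument `(pre w, [])`, coded
  have hin : PolyTimeComputable (id : List Bool → List Bool)
      (fun p : List Bool × List (List Bool) => boolPair p.1 ((encodingList Bool).listBool.encode p.2))
      (fun w : List Bool => (pre w, ([] : List (List Bool)))) := by
    refine PolyTimeComputable.of_encode (fanoutFn_mem_FP hpre (const_mem_FP [false, true])) id (fun _ => rfl) fun w => ?_
    simp only [id, fanoutFn_apply]
    rfl
  have hstep : PolyTimeComputable (id : List Bool → List Bool) ((encodingList Bool).sumBool eb).encode
      (fun w : List Bool => M.step (pre w) []) := by
    have h := PolyTimeComputable.comp_holds hM hin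
    exact h
  -- the complemented tag bit
  have htag : PolyTimeComputable ((encodingList Bool).sumBool eb).encode (id : List Bool → List Bool)
      (fun r : List Bool ⊕ β => match r with | Sum.inl _ => [true] | Sum.inr _ => [false]) := by
    refine PolyTimeComputable.of_encode (notFn_mem_FP headBitFn_mem_FP) ((encodingList Bool).sumBool eb).encode
      (fun _ => rfl) fun r => ?_
    cases r with
    | inl q => simp [Encoding.sumBool, notFn_apply (headBitFn_apply _)]
    | inr b => simp [Encoding.sumBool, notFn_apply (headBitFn_apply _)]
  have h := PolyTimeComputable.comp_holds htag hstep
  refine PolyTimeComputable.of_encode h id (fun _ => rfl) fun w => ?_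
  simp only [Function.comp_apply, id, asksFirstFn]

/-! ### Pair outputs -/

/-- The one-query algorithm with its outputs re-read as pairs `(fstF s, sndF s)` (for the forgers of the
signature games). [Goldreich 2004, proof of Prop. 6.4.31] [cite: Goldreich2004, Prop. 6.4.31] -/
def oneQueryPair : OracleAlg (List Bool × List Bool) :=
  (oneQuery D Q Out₀ Out₁).mapOut fun s => (fstF s, sndF s)

/-- **`oneQueryPair` is polynomial-time** when, in addition, `Out₀` and `Out₁` are pair-shaped (their
values are their own re-pairing). [cite: AroraBarak2009, §3.4] -/
theorem isPolyTime_oneQueryPair (hD : D ∈ FP) (hD1 : OneBit D) (hQ : Q ∈ FP) (h₀ : Out₀ ∈ FP) (h₁ : Out₁ ∈ FP)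
    (hp₀ : ∀ z, boolPair (fstF (Out₀ z)) (sndF (Out₀ z)) = Out₀ z) (hp₁ : ∀ z, boolPair (fstF (Out₁ z)) (sndF (Out₁ z)) = Out₁ z) :
    (oneQueryPair D Q Out₀ Out₁).IsPolyTime ((encodingList Bool).pairBool (encodingList Bool)) := by
  refine (isPolyTime_oneQuery D Q Out₀ Out₁ hD hD1 hQ h₀ h₁).mapOut_of_range _ fun x as b hs => ?_
  show boolPair (fstF b) (sndF b) = b
  rcases as with _ | ⟨a, _ | ⟨a', rest⟩⟩
  · simp only [oneQuery] at hs
    split_ifs at hs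
    rw [Sum.inr.injEq] at hs
    rw [← hs, hp₀]
  · simp only [oneQuery, Sum.inr.injEq] at hs
    rw [← hs, hp₁]
  · simp only [oneQuery, Sum.inr.injEq] at hs
    rw [← hs]
    simp

/-- Run of `oneQueryPair`, querying case. [folklore] -/
theorem run_oneQueryPair_pos (O : Oracle) {x : List Bool} (hD : D x = [true]) (k : ℕ) :
    (oneQueryPair D Q Out₀ Out₁).run O (k + 2) x =
      some (fstF (Out₁ (boolPair x (O (Q x)))), sndF (Out₁ (boolPair x (O (Q x))))) := by
  rw [oneQueryPair, run, runAux_mapOut, ← run, run_oneQuery_pos D Q Out₀ Out₁ O hD]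
  rfl

/-- Transcript of `oneQueryPair`, querying case. [folklore] -/
theorem queries_oneQueryPair_pos (O : Oracle) {x : List Bool} (hD : D x = [true]) (k : ℕ) :
    (oneQueryPair D Q Out₀ Out₁).queries O (k + 2) x = [Q x] := by
  rw [oneQueryPair, queries, queriesAux_mapOut, ← queries, queries_oneQuery_pos D Q Out₀ Out₁ O hD]

/-- Run of `oneQueryPair`, silent case. [folklore] -/
theorem run_oneQueryPair_neg (O : Oracle) {x : List Bool} (hD : D x ≠ [true]) (k : ℕ) :
    (oneQueryPair D Q Out₀ Out₁).run O (k + 1) x = some (fstF (Out₀ x), sndF (Out₀ x)) := by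
  rw [oneQueryPair, run, runAux_mapOut, ← run, run_oneQuery_neg D Q Out₀ Out₁ O hD]
  rfl

/-- Transcript of `oneQueryPair`, silent case. [folklore] -/
theorem queries_oneQueryPair_neg (O : Oracle) {x : List Bool} (hD : D x ≠ [true]) (k : ℕ) :
    (oneQueryPair D Q Out₀ Out₁).queries O (k + 1) x = [] := by
  rw [oneQueryPair, queries, queriesAux_mapOut, ← queries, queries_oneQuery_neg D Q Out₀ Out₁ O hD]

/-- Every transcript of `oneQueryPair` has at most the one query `Q x`. [folklore] -/
theorem queries_oneQueryPair_subset (O : Oracle) (x : List Bool) (k : ℕ) :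
    ∀ q ∈ (oneQueryPair D Q Out₀ Out₁).queries O k x, q = Q x := by
  rw [oneQueryPair, queries, queriesAux_mapOut]
  exact queries_oneQuery_subset D Q Out₀ Out₁ O x k

end OracleAlg

end Literature.Computability.Complexity
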